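import Summits.BirchSwinnertonDyer.Rank1Residual.F1Sign2.AdditiveNewPartLawsAtTwo
import HarnessLib

/-!
# Cell `bsd-f1-sign2`, lens `-imc` g7 (MEMO-imc §10.66, D-imc-24): THE NEW-PART LAW IS ONE LAW FOR EVERY REDUCTION TYPE AT `2` —
# rows IMC-NP2-SIGN `NewPartSignLawAtTwo`, IMC-NP2-INC `NewPartShaIncrementAtTwo`, IMC-NP2-LB `NewPartValuationLowerBoundAtTwo`
# (`@[conjecture]`), scope predicates `NewPartNonvanishing`, `NewPartEulerFree`; glue `newPartIndex_sub_rank_even_nonneg` (PROVED)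

SIBLING of the landed `F1Sign2/AdditiveNewPartLawsAtTwo.lean` (p628841; helpers `newPartNormTwoVal`, `layerTwoMinDiscOrd`, `LayerAdditiveAboveTwo`,
`layerMordellWeilRank`, `additiveNewPartIndex` and rows IMC-ADD2-DEFL/W/SIGN/INC are used BY NAME — nothing copied; the tree is append-only, so
`additiveNewPartIndex` keeps its name and IMC-ADD2-INC stays as the held-out-certified additive special case; IMC-ADD2-DEFL is PROVED in
`F1Sign2/AdditiveNewPartLawsAtTwoProofs.lean`).  STATEMENTS: three `@[conjecture] def … : Prop` (nothing asserted) + two scope predicates with bodies + one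
`example` (`LayerAdditiveAboveTwo n → NewPartEulerFree n`, `Or.inl`) + one PROVED glue theorem (REF1 §99 e2: SIGN ∧ LB ⇒ `R*_n` is a non-negative even integer).
No `instance`, no `notation`, no Literature fact, no `sorry`.

TYPER FILING (cell `bsd-f1-sign2`, seat `-ty` g9; CANDIDATES.md rows IMC-NP2-SIGN/INC/LB; -imc g7 CANDIDATES-delta v2 2026-08-28T11:18:12Z + v2.1 11:35:57Z):
the five new declarations and the example of `HOME/MEMO-imc-data/dimc26/SketchG7NewPartV21.lean` 708e377d8d2e9eb7 (= SketchG7Add2 91185957d674fe09 + these;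
supersedes `dimc24/SketchG7NewPart.lean` 93703e294a39c44a = the same minus LB; -imc: farm rc 0 · 0/0/0; BC7 `ProbeG7NewPartV21.lean` c43b0e664ca03099 3/3
CLEAN) VERBATIM (l.133–199); typer edits = this header, the REF1/REF2 sentences in the row docstrings, the glue theorem.  Filed after REF1 §97/§99
(gate D-ty-ref1-24 CLEARED 11:31:43Z / 11:43:50Z).  Builder `tools/mk_np2.py` (`HOME/MEMO-ty-data/g9/`).
REF1-AUDIT §97/§99 (refuter-bsd-f1-sign2-ref1 g9; gate D-ty-ref1-24 CLEARED 11:31:43Z, v2.1 LB CLEARED 11:43:50Z): NP2-SIGN, NP2-INC, NP2-LB SURVIVE as typed (conj-grade: BSD₂ at two layers + Ш finite (+ CT for INC); no-capitulation step for LB; every hypothesis but ¬CM load-bearing), KILLED none; Probe97 ec4d3a51b3707986 + Probe99 b0777ab4f53fc034 rc 0·0·0·0, e-lemmas trio; independent recount θ-side 17 702/17 702 (R* ≥ 0 even, parity), Selmer law 1 917/1 917 (D-imc-24) + 2 070/2 070 (D-imc-26 held-out, PRED-26.json 8020e49548ae411d reproduced 2 510/2 510) + 5 596 additive = 9 583/9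 583; six capitulation towers confirmed as the only B-ZERO-increment failures, outside scope; riders §97 r1 (the typed `NewPartEulerFree` excludes every layer n ≥ k₀ of an additive-over-ℚ curve, e1b), r2 (SIGN's rank-parity proxy is EXACT on all cells: layer-k new parts have rank ≡ 0 mod 2^{k−1}), r3 CLOSED in §99, r4 = §95 r3 (¬CM unused by the derivation; D-ref1-imc-22a open), r5 (θ-side job ids named); landing certificate p628841 cmpdecls 9/9 SAME.
REF2-PLACEMENT v26 §2 (825bab749434eaba, 2026-08-28T11:31:05Z): SAME placement as the additive rows (v25 §2.5: VARIANT — BSD₂-term bookkeeping along the tower; objects print = Doyon–Lei 2021; laws not in print at 2; beyond-print theorem no) with one RIDER (r2): the Mordell–Weil-rank form typed here = the root-number (or 2^∞-Selmer-corank) form + the parity conjecture for E, E^{(2)} — strictly LESS provable — REF2 recommends keeping the root-number form (`AdditiveNewPartSignLawAtTwo`) as row of record (planner's call); v26 §1: on the additive side SIGN_n (n ≥ 2) SPLITS into (A) a functional-equation leg (print assembly; parity(ℓ′_n) = [χ₈(N′) = −1] ⊕ X_n(E/ℚ₂), 0 mixed / 726 2-adic-type groups) ⊕ (B) a 2-LOCAL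 law X_n ⊕ δu_n ⊕ δTam₂_n ≡ [ρ₂ = −1], ρ₂ = w₂(E)w₂(E^{(2)}) = w(E/ℚ₂(√2)) (8 169/8 169; NOT in print — the Tamagawa form of Kramer–Tunnell in DD 2011's «most horrible case»; NEW-COMBINATION statement, theorem-grade target, beyond-print yes-small if proved for all types); for E semistable at 2 and n ≥ 2, X_n = 0 and SIGN_n is a theorem on paper (MTT functional equation at 2); §3 (D-imc-25): the n = 1 layer («v₂ #Ш_an(E₈) even») is OPEN in print at additive 2. PARTITION none.
REF2-PLACEMENT v27 §1 (6ecf6d15f11cef6e, 2026-08-28T11:59:32Z): IMC-NP2-LB PLACED — NOT IN PRINT at `p = 2` as stated; conjecture-grade = the MT87 / BD94 order-of-vanishing conjecture for `ℚ_n/ℚ_{n−1}` + leading-term bookkeeping; grade VARIANT; ⟸ BSD₂ at two layers ∧ Ш finite (concur REF1 §99); theorem floors in print at 2: good-ordinary Tamagawa-free core (Kato 17.4(2) + 2-integrality + Weierstrass division; `δTam_n` is the BSD₂-grade residue), multiplicative Kato 18.4 (partial), KO corner `a₂ = ±2` with EQUALITY (Kurihara–Otsuki 2006), `a₂ = 0`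 / additive analytic side only; REF2_TXT §1.8 folded verbatim into the LB docstring, riders r1–r4 recorded there and (r2) in INC; beyond-print theorem: no.  REF1 §101 (11:58:31Z): landing certificate p631009 cmpdecls 5/5 SAME vs audited V21 + glue trio.

WHAT THIS SAYS ABOUT THE SEARCH QUESTION (-imc §10.66, verbatim in substance): the «± object at 2» found on the additive third is not an additive
phenomenon — for EVERY non-CM `E/ℚ` with `E(ℚ)[2] = 0` and every layer `n ≥ 1` of the cyclotomic `ℤ₂`-tower whose new twisted `L`-value is
non-zero (and which is not an Euler-correction layer), the single integer `R_n = v_π(χ(θ_n)) − δu_n − δTam_n` has the parity of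
`rank E(ℚ_{n−1})` and `R_n − rank E(ℚ_{n−1})` is the exponent of the new `2`-part of Ш, located exactly by the `2`-Selmer towers (cumulative
census of record, MEMO-imc §10.67 / REF1 §99 recount: parity **17 702/17 702** θ-cells; THE LAW on `σ = 0` cells **9 583/9 583** over all four
reduction types — additive 5 596, semistable D-imc-24 1 917 + D-imc-26 held-out 2 070 (`1 200 < N ≤ 2 500`, `PRED-26.json` 8020e49548ae411d posted
before the Selmer job) —, 7 910 of them predicted per cell before their Selmer data existed; 0 violations).  Reduction type enters only through
(i) DEFLATION `θ_n = ω_{n−1}φ_n` (additive, `a₂ = 0`; PROVED: `additiveMazurTateDeflationAtTwo_holds`), (ii) the Euler correction `ε` at the first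
semistable layer `k₀` of an additive-over-`ℚ` curve — the typed `NewPartEulerFree` («additive above `2` at layer `n` ∨ semistable at `2` over `ℚ`»)
excludes EVERY layer `n ≥ k₀` of such a curve, not only `n = k₀` (REF1 §97 r1; typed = safe; the census shows the law holds again above `k₀` with
`ε = 0`, 27/27 — ask D-imc-27 for the ε-row), (iii) `δu_n ≠ 0` only while the curve is additive.  θ-side jobs of record: D-imc-22 j306010,
D-imc-24 j306924 (`rows22_R.json` 30409a92ca7c507b), D-imc-26 j307227; Selmer j306011 / j306979 / j307270 (REF1 §97 r5).  DESIGN D-imc-24 (pre-registration P27 `MEMO-imc-data/dimc24/README-24.md`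
2f4edfcb1af244bf posted before the θ output was read; per-cell Selmer predictions `PRED-24.json` b8e1265c0a988a64 posted before j306979 was submitted;
population: the 1 381 odd-torsion non-CM class representatives with `4 ∤ N ≤ 1 200`; internal θ checks: good three-term relation 2 464/2 464, multiplicative
two-term relation 3 060/3 060; `δu_n = 0` throughout).  HONESTY LINES (-imc): the pre-registered ADDENDUM-1 law «`R_n` even» (no rank term) was killed
1 981/4 074 on the additive side; expectation P27-5 («`R* = 0` almost everywhere on the ord/mult side») was WRONG as an expectation (2-Ш does grow at
finite layers of ordinary and multiplicative towers) — the LAW is what is on trial and has 0 violations; B-ZERO in increment form fails on 6 capitulation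
towers at `n = 3` (201b1, 249b1, 338a1, 522i1, 567b1, 486b1: `Ш(E/ℚ_2)[2] ≅ (ℤ/2)²` predicted and observed at layer 2 dies in `ℚ_3`) — not a kill rule,
the cumulative B-ZERO′ holds 3 032/3 032.  WHY NOVEL / PLACEMENT: as for the additive rows (REF2 v25 §2: VARIANT — BSD₂-term bookkeeping along the
tower, objects print, laws not in print at `2`); on the good-supersingular side a strictly SHARPER reading of the D17 towers than the MTF2 pair laws.
PARTITION: none; beyond-print theorem: no.  BSD is not proved by any of this.
-/

noncomputable section

open scoped Classical MatrixGroups ModularForm NumberField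

open CongruenceSubgroup Polynomial WeierstrassCurve Literature.NumberTheory.EllipticCurves
  Literature.NumberTheory.EllipticCurves.ModularForms
  Literature.NumberTheory.EllipticCurves.Rank1Residual ZpExtension IsDedekindDomain

open Literature.Barriers.BirchSwinnertonDyer (nRankAtLeast)

namespace Summit.BirchSwinnertonDyer.Rank1Residual.F1Sign2

/-! ### The UNIFIED new-part law (all reduction types at `2`; D-imc-24)

On the semistable-at-`2` side (good ordinary, good supersingular, multiplicative) the same corrected valuation `R_n` obeys the
same two laws with NO Euler correction and `δu_n = 0` (semistable reduction is stable), once «`θ_n ≠ 0`» is replaced by «the NEW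
PART of `θ_n` is non-zero» (for additive `W` the two agree, all old components of `θ_n` vanishing by deflation). The only layers
excluded are the Euler-correction layers of the additive side: `W` additive above `2` over `ℚ_{n−1}` but semistable over `ℚ_n`
(there `W` is a twist of a semistable curve by a new character and `L₂(W ⊗ χ̄, s) ≠ 1`). -/

/-- The new part of `P ∈ ℚ[T]` at layer `n` is non-zero: `χ(P) ≠ 0` for the characters `χ` of exact order `2^n`, i.e. the
resultant of `P` with `Φ_{2^n}(X + 1)` is non-zero. For `P = ϖ·θ_n(f)`: `L(f, χ̄, 1) ≠ 0` for the new characters of `ℚ_n/ℚ`. -/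
def NewPartNonvanishing (n : ℕ) (P : ℚ[X]) : Prop :=
  Polynomial.resultant ((Polynomial.cyclotomic (2 ^ n) ℚ).comp (X + 1)) P ≠ 0

/-- No Euler correction at layer `n ≥ 1`: either `W` is still additive above `2` over `ℚ_n`, or `W` is already semistable at `2`
over `ℚ = ℚ_0` (then `W ⊗ χ` is additive at `2` for every character `χ` ramified at `2`, so the new part of
`BSD(W/ℚ_n)/BSD(W/ℚ_{n−1})` carries no Euler factor). -/
def NewPartEulerFree (W : WeierstrassCurve ℚ) (κ : ZpExtension ℚ 2) (n : ℕ) : Prop :=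
  LayerAdditiveAboveTwo W κ n ∨ ¬ LayerAdditiveAboveTwo W κ 0

/-- **IMC-NP2-SIGN `NewPartSignLawAtTwo`** — candidate, conjecture-grade (consequence of BSD₂ for `W` over `ℚ_n` and `ℚ_{n−1}`
+ Cassels–Tate; OPEN as stated), THE SIGNED OBJECT AT `2` FOR EVERY REDUCTION TYPE: for `W/ℚ` globally minimal, non-CM,
`W(ℚ)[2] = 0`, newform `f`, period pin, cyclotomic `κ`, a layer `n ≥ 1` free of Euler correction and with non-zero new part:
`R_n ≡ rank W(ℚ_{n−1}) (mod 2)`. Supersedes `AdditiveNewPartSignLawAtTwo` (its additive case, with the rank parity written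
through root numbers). Census (θ-side; Mordell–Weil ranks of `W`, `W^{(2)}` from Cremona's table, rank jumps at layers `k ≥ 2`
taken with multiplicity one): additive `N ≤ 6 000` 10 142/10 142 cells (D-imc-22/23), semistable at `2`, `N ≤ 1 200`:
3 185/3 185 cells (D-imc-24: 765 multiplicative, 186 good-ordinary, 430 good-supersingular curves; `n ≤ 3`); total 13 327/13 327,
of which the `n ≤ 2` cells (8 656) use only certain ranks.
REF1-AUDIT §97/§99 (refuter-bsd-f1-sign2-ref1 g9; gate D-ty-ref1-24 CLEARED 11:31:43Z, v2.1 LB CLEARED 11:43:50Z): NP2-SIGN, NP2-INC, NP2-LB SURVIVE as typed (conj-grade: BSD₂ at two layers + Ш finite (+ CT for INC); no-capitulation step for LB; every hypothesis but ¬CM load-bearing), KILLED none; Probe97 ec4d3a51b3707986 + Probe99 b0777ab4f53fc034 rc 0·0·0·0, e-lemmas trio; independent recount θ-side 17 702/17 702 (R* ≥ 0 even, parity), Selmer law 1 917/1 917 (D-imc-24) + 2 070/2 070 (D-imc-26 held-out, PRED-26.json 8020e49548ae411d reproduced 2 510/2 510) + 5 596 additive = 9 583/9 583; six capitulation towers confirmed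 as the only B-ZERO-increment failures, outside scope; riders §97 r1 (the typed `NewPartEulerFree` excludes every layer n ≥ k₀ of an additive-over-ℚ curve, e1b), r2 (SIGN's rank-parity proxy is EXACT on all cells: layer-k new parts have rank ≡ 0 mod 2^{k−1}), r3 CLOSED in §99, r4 = §95 r3 (¬CM unused by the derivation; D-ref1-imc-22a open), r5 (θ-side job ids named); landing certificate p628841 cmpdecls 9/9 SAME.
REF2-PLACEMENT v26 §2 (825bab749434eaba, 2026-08-28T11:31:05Z): SAME placement as the additive rows (v25 §2.5: VARIANT — BSD₂-term bookkeeping along the tower; objects print = Doyon–Lei 2021; laws not in print at 2; beyond-print theorem no) with one RIDER (r2): the Mordell–Weil-rank form typed here = the root-number (or 2^∞-Selmer-corank) form + the parity conjecture for E, E^{(2)} — strictly LESS provable — REF2 recommends keeping the root-number form (`AdditiveNewPartSignLawAtTwo`) as row of record (planner's call); v26 §1: on the additive side SIGN_n (n ≥ 2) SPLITS into (A) a functional-equation leg (print assembly; parity(ℓ′_n) = [χ₈(N′) = −1] ⊕ X_n(E/ℚ₂), 0 mixed / 726 2-adic-type groups) ⊕ (B) a 2-LOCAL law X_n ⊕ δu_n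 ⊕ δTam₂_n ≡ [ρ₂ = −1], ρ₂ = w₂(E)w₂(E^{(2)}) = w(E/ℚ₂(√2)) (8 169/8 169; NOT in print — the Tamagawa form of Kramer–Tunnell in DD 2011's «most horrible case»; NEW-COMBINATION statement, theorem-grade target, beyond-print yes-small if proved for all types); for E semistable at 2 and n ≥ 2, X_n = 0 and SIGN_n is a theorem on paper (MTT functional equation at 2); §3 (D-imc-25): the n = 1 layer («v₂ #Ш_an(E₈) even») is OPEN in print at additive 2. PARTITION none.
[cite: DoyonLei2021, §5] [cite: DokchitserDokchitser2010, Thm. 1.3, 1.4] [cite: Kato2004Asterisque, Thm. 17.4] -/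
@[conjecture] def NewPartSignLawAtTwo : Prop :=
  ∀ {N : ℕ} [NeZero N] (f : CuspForm (Gamma0 N) 2) (W : WeierstrassCurve ℚ) [W.IsElliptic] [W.IsGloballyMinimal]
    (ϖ : ℚ), IsNewformOf W f → ¬ W.HasCM → NoRationalTwoTorsion W →
    (ϖ : ℝ) * W.realPeriodRat = plusPeriod f →
    ∀ (κ : ZpExtension ℚ 2), κ.IsCyclotomic →
    ∀ n : ℕ, 1 ≤ n → NewPartEulerFree W κ n → NewPartNonvanishing n (C ϖ * mazurTateElement f 2 n) →
      (Even (additiveNewPartIndex f W ϖ κ n) ↔ Even (layerMordellWeilRank W κ (n - 1)))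

/-- **IMC-NP2-INC `NewPartShaIncrementAtTwo`** — candidate, conjecture-grade (BSD₂ over the layers + Cassels–Tate; OPEN):
for every reduction type, with `r := rank W(ℚ_{n−1})` and `R*_n := R_n − r`, if `Ш(W/ℚ_{n−1})[2] = 0` then
(a) `R*_n ≥ 0`; (b) `rk₂ Sel_{2^∞}(W/ℚ_n) ≤ r + R*_n`; (c) `R*_n ≥ 1 ⇒ rk₂ Sel_{2^∞}(W/ℚ_n) ≥ r + 2`. Supersedes
`AdditiveNewPartShaIncrementAtTwo`. Census (engine A two-level cells ⋈ θ-side, `σ_{n−1} = 0` cells): additive 5 596/5 596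
(3 923 of them held-out with pre-registered per-cell predictions); semistable side D-imc-24: THE LAW on `σ_{n−1} = 0` cells 1 917/1 917
(`n = 1`: 570, `n = 2`: 1 018, `n = 3`: 329; multiplicative 1 048/1 048, good-ordinary 270/270, good-supersingular 599/599; zero growth predicted and
observed 1 436, growth predicted and observed 481, strict `d < R*` 92), literal check against the pre-registered `PRED-24.json` b8e1265c0a988a64:
0 violations; cumulative over all four reduction types 7 513/7 513 `σ = 0` cells. KILL: one `σ_{n−1} = 0` cell, new part non-zero, Euler-free,
with `R*_n = 0 < d_n` or `d_n > R*_n` or `R*_n > 0 = d_n`.  REF1-AUDIT §97/§99 (refuter-bsd-f1-sign2-ref1 g9; gate D-ty-ref1-24 CLEARED 11:31:43Z, v2.1 LB CLEARED 11:43:50Z): NP2-SIGN, NP2-INC, NP2-LB SURVIVE as typed (conj-grade: BSD₂ at two layers + Ш finite (+ CT for INC); no-capitulation step for LB; every hypothesis but ¬CM load-bearing), KILLED none; Probe97 ec4d3a51b3707986 + Probe99 b0777ab4f53fc034 rc 0·0·0·0, e-lemmas trio; independent recount θ-side 17 702/17 702 (R* ≥ 0 even, parity), Selmer law 1 917/1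 917 (D-imc-24) + 2 070/2 070 (D-imc-26 held-out, PRED-26.json 8020e49548ae411d reproduced 2 510/2 510) + 5 596 additive = 9 583/9 583; six capitulation towers confirmed as the only B-ZERO-increment failures, outside scope; riders §97 r1 (the typed `NewPartEulerFree` excludes every layer n ≥ k₀ of an additive-over-ℚ curve, e1b), r2 (SIGN's rank-parity proxy is EXACT on all cells: layer-k new parts have rank ≡ 0 mod 2^{k−1}), r3 CLOSED in §99, r4 = §95 r3 (¬CM unused by the derivation; D-ref1-imc-22a open), r5 (θ-side job ids named); landing certificate p628841 cmpdecls 9/9 SAME.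
REF2 v27 §1.7 r2 (the KO corner, IN PRINT WITH EQUALITY): for supersingular `a₂ = ±2` with `ord₂ L(E,1)/Ω_E = ord₂ Tam E = 0` the increment law
holds with equality — Kurihara–Otsuki 2006 Thm 0.1(2) + Prop 1.3: `v_π ψ_n(θ_{ℚ_n}) = q_n` and `v₂#Ш_n − v₂#Ш_{n−1} = q_n − 1 = R*_n` (11a1:
`R*_2 = 0`, `R*_3 = 2`). [cite: KuriharaOtsuki2006, Thm. 0.1, Prop. 1.3] -/
@[conjecture] def NewPartShaIncrementAtTwo : Prop :=
  ∀ {N : ℕ} [NeZero N] (f : CuspForm (Gamma0 N) 2) (W : WeierstrassCurve ℚ) [W.IsElliptic] [W.IsGloballyMinimal]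
    (ϖ : ℚ), IsNewformOf W f → ¬ W.HasCM → NoRationalTwoTorsion W →
    (ϖ : ℝ) * W.realPeriodRat = plusPeriod f →
    ∀ (κ : ZpExtension ℚ 2), κ.IsCyclotomic →
    ∀ n : ℕ, 1 ≤ n → NewPartEulerFree W κ n → NewPartNonvanishing n (C ϖ * mazurTateElement f 2 n) →
      ¬ nRankAtLeast (↥(W.selmerLayer κ (n - 1))) 2 (layerMordellWeilRank W κ (n - 1) + 1) →
      0 ≤ additiveNewPartIndex f W ϖ κ n - layerMordellWeilRank W κ (n - 1) ∧
      (∀ k : ℕ, nRankAtLeast (↥(W.selmerLayer κ n)) 2 k →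
          (k : ℤ) ≤ additiveNewPartIndex f W ϖ κ n) ∧
      (1 ≤ additiveNewPartIndex f W ϖ κ n - layerMordellWeilRank W κ (n - 1) →
          nRankAtLeast (↥(W.selmerLayer κ n)) 2 (layerMordellWeilRank W κ (n - 1) + 2))

/-- **IMC-NP2-LB `NewPartValuationLowerBoundAtTwo`** — candidate, the KATO-DIRECTION HALF of the law (conjecture-grade
as stated; the natural first prover target: a divisibility `char Sel ∣ θ` at `p = 2` with control would give it): in the frame of
`NewPartSignLawAtTwo`, `rank W(ℚ_{n−1}) ≤ R_n`, i.e. `R*_n ≥ 0` — the new twisted L-values vanish π-adically at least to the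
order forced by the Mordell–Weil rank already present. No Selmer hypothesis. Census (θ-side): `R*_n ≥ 0` on 17 702/17 702 cells
(additive N ≤ 6 000, semistable N ≤ 2 500, n ≤ 3), never negative.
REF1 §99 (CANDIDATES-delta v2.1, 11:43:50Z): SURVIVES as typed, conjecture-grade (BSD₂ at two layers + Ш finite + one extra paper step w.r.t. SIGN:
NO CAPITULATION of `Ш[2^∞]` from `ℚ_{n−1}` to `ℚ_n` on the cells — `M^{σ=−1}` finite of odd order ⇐ no rank jump + no 2-torsion; the six
capitulation towers of D-imc-24 are exactly where `NewPartNonvanishing` fails), CLEARED; LB = INC (a) minus the Selmer hypothesis (kernel e1),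
SIGN ∧ LB = «`R*_n` non-negative even» (e2, re-proved below as `newPartIndex_sub_rank_even_nonneg`); riders: r1 multiplicity-one caveat for the
`n = 3` cells with a layer-2 zero (129 + 179 cells: the census certifies `R_n ≥ r^{min}` only); r2 typed-scope count = 17 702 − 50 ε-cells − the
post-`k₀` cells; r3 «a divisibility `char Sel ∣ θ` at `p = 2` with control would give it» is a HEURISTIC remark (Kato's divisibility at `2` carries
the error terms of Thm 17.4).  REF2-PLACEMENT v27 §1 (6ecf6d15f11cef6e, 2026-08-28T11:59:32Z; REF2_TXT_LB §1.8 verbatim): NOT IN PRINT at p = 2 as stated; conjecture-grade; grade VARIANT. LB is the Mazur–Tate order-of-vanishing conjecture for the relative layer ℚ_n/ℚ_{n−1} over the base ℚ_{n−1} (MT87 Conj. 1 over ℚ; Bertolini–Darmon 1994 Conj. 4.3 over a totally real base, which inverts 2) read through the norm to ℤ₂[ζ_{2^n}], plus leading-term Tamagawa/period bookkeeping (Dokchitser–Dokchitser 2010; DEW21 (10)–(11)); it follows from BSD₂(E/ℚ_n) ∧ BSD₂(E/ℚ_{n−1}) ∧ Ш finite on the cells (no 2-capitulation, REF1 §99;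 printed pattern BD94 Thm 4.8 / Tan). Printed theorems reaching it: good ordinary at 2, Tamagawa-free core ℓ′_n ≥ rank E(ℚ_{n−1}) = assembly of Kato 2004 Thm 17.4(2) (no parity hypothesis) + 2-integrality of θ_{ℚ_n} (Stevens 1989 / Česnavičius 2018; arXiv:2511.07203 Thm 7.2; Kurihara–Otsuki 2006 p.562) + Weierstrass division; multiplicative at 2: Kato Thm 18.4 (rank E(ℚ)+[Tate] part only); supersingular a₂ = ±2 with ord₂ L(E,1)/Ω_E = ord₂ Tam E = 0: the law holds WITH EQUALITY by Kurihara–Otsuki 2006 Thm 0.1(2) + Prop 1.3 (R*_n = q_n − 1); a₂ = 0 / additive: ± objects printed at 2 (Pollack 2003, arXiv:2302.05748 §2), algebraic side odd p only. All order-of-vanishing theorems for Mazur–Tate elements reaching the rank (arXiv:2511.07203 Thm 1.4, Ota 2018, Kim–Kurihara 2021, BD94/95) are at odd p or invert 2. Beyond-print theorem: no.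
RIDERS (REF2 v27 §1.7, docstring-only): (r2, the KO corner) for `a₂ = ±2` with `ord₂ L(E,1)/Ω_E = ord₂ Tam E = 0` the law holds with EQUALITY in
print — Kurihara–Otsuki 2006 Thm 0.1(2) + Prop 1.3: `R*_n = q_n − 1 = v₂#Ш_n − v₂#Ш_{n−1}` (11a1: `R*_2 = 0`, `R*_3 = 2`); (r3) the clause «a
divisibility `char Sel ∣ θ` at `p = 2` with control would give it» sharpened: on the good-ordinary third the Tamagawa-free inequality IS Kato
17.4(2) + 2-integrality + Weierstrass division (v27 §1.4a); what no divisibility gives at a FINITE layer is `δTam_n` (control-kernel orders), so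
the sharp row is BSD₂-grade by nature, not «Kato + ε»; (r1, to REF1) printed 2-integrality is «`c_∞·θ ∈ ℤ₂[G_M]`» for the full group
`G_M = (ℤ/2^{n+2})^×`, `c_∞` cancelling only on the even projection — ANSWERED by REF1 §103 (2026-08-28T12:04:40Z): YES, in TREE conventions
`mazurTateElement f 2 n ∈ ℤ_(2)[X]` for every `n` and every reduction type at `2` given only `E(ℚ)[2] = 0` (coefficients `2·[a/2^{n+2}]⁺_f` by
`Sprung2017.mazurTateElement_two_eq`, symbols half-integral at `2` by `norm_ratPlusSymbol_two_le_two` with an odd Eisenstein annihilator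
`ℓ + 1 − a_ℓ`, which exists by Chebotarev under `NoRationalTwoTorsion`; kernel outright for `2 ∤ N`, `a₂` even:
`exists_map_eq_map_mazurTateElement_two`), and `ϖ` is a `2`-adic unit whenever the Manin constant `c₀` of the optimal curve is odd — so
`C ϖ * mazurTateElement f 2 n` is 2-integral on `NoRationalTwoTorsion ∧ 4 ∤ N_W` unconditionally on paper (Abbes–Ullmo for `2 ∤ N`, Česnavičius
2018 for `2 ∥ N`; tree fact `realPeriodRat_eq_unit_mul_plusPeriod_two` for good `2`) and on `4 ∣ N_W` modulo «`c₀` odd»; print's `c_∞` is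
inside the tree's `Ω⁺_f = ∫_{E(ℝ)}|ω|` and the half-symbol `½` is cancelled by the `±`-doubling — no residual factor (Wuthrich 2014's
non-integral `p = 2` examples 17a/98a have rational 2-torsion, outside the frame).  REF1 §103 r1 (the honest dependency, not a hypothesis of the
rows — they are statements about valuations of norms): on the ADDITIVE layers / `4 ∣ N_W` these rows and the ADD2 rows silently assume the Manin
constant `c₀` of the optimal curve is ODD (true throughout Cremona's tables, conjectural in general); a curve with even `c₀` would shift every
`R_n` by `v₂(c₀)` (SIGN would flip for `2 ∥ c₀`, INC/LB shift); for `4 ∤ N_W` no caveat; (r4, D-imc-29) the modular-symbol-only rung lives on the `a₂ = 0` / additive third, stated on `φ_n`: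
`v_π χ_n(ϖφ_n) ≥ r_{n−1} + δu_n + δTam_n − 2^{n−1}` (`v_π χ_n(ω_{n−1}) = 2^{n−1}` explicit).
[cite: MazurTate1987, Conj. 1, 3] [cite: BertoliniDarmon1994, Conj. 4.3, Thm. 4.8] [cite: Kato2004Asterisque, Thm. 17.4(2), Thm. 18.4]
[cite: KuriharaOtsuki2006, Thm. 0.1, Prop. 1.3] [cite: BullachHonnor2025, Thm. 1.4, Thm. 7.2] [cite: DoyonLei2021, §5] -/
@[conjecture] def NewPartValuationLowerBoundAtTwo : Prop :=
  ∀ {N : ℕ} [NeZero N] (f : CuspForm (Gamma0 N) 2) (W : WeierstrassCurve ℚ) [W.IsElliptic] [W.IsGloballyMinimal]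
    (ϖ : ℚ), IsNewformOf W f → ¬ W.HasCM → NoRationalTwoTorsion W →
    (ϖ : ℝ) * W.realPeriodRat = plusPeriod f →
    ∀ (κ : ZpExtension ℚ 2), κ.IsCyclotomic →
    ∀ n : ℕ, 1 ≤ n → NewPartEulerFree W κ n → NewPartNonvanishing n (C ϖ * mazurTateElement f 2 n) →
      (layerMordellWeilRank W κ (n - 1) : ℤ) ≤ additiveNewPartIndex f W ϖ κ n

/-- The additive rows are the additive cases of the unified rows (bookkeeping, provable: `4 ∣ N_W` with additivity above `2`
at layer `n` gives `NewPartEulerFree`, and `θ_n ≠ 0 ↔ NewPartNonvanishing` under deflation; the root-number form of the rank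
parity needs the parity conjecture for `W` and `W^{(2)}`, which is why it is NOT claimed here as an implication). -/
example (W : WeierstrassCurve ℚ) (κ : ZpExtension ℚ 2) (n : ℕ) (h : LayerAdditiveAboveTwo W κ n) :
    NewPartEulerFree W κ n := Or.inl h

/-! ### Glue (REF1 §99 e2, PROVED): SIGN ∧ LB ⇒ `R*_n = R_n − rank W(ℚ_{n−1})` is a non-negative EVEN integer
(the θ-side census statement P27-1/P28-1 exactly: 17 702/17 702 cells). -/

/-- **SIGN ∧ LB ⇒ `R*_n ≥ 0` and even** (in the common frame of the three rows). -/
theorem newPartIndex_sub_rank_even_nonneg (hS : NewPartSignLawAtTwo) (hL : NewPartValuationLowerBoundAtTwo) :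
    ∀ {N : ℕ} [NeZero N] (f : CuspForm (Gamma0 N) 2) (W : WeierstrassCurve ℚ) [W.IsElliptic] [W.IsGloballyMinimal]
      (ϖ : ℚ), IsNewformOf W f → ¬ W.HasCM → NoRationalTwoTorsion W →
      (ϖ : ℝ) * W.realPeriodRat = plusPeriod f →
      ∀ (κ : ZpExtension ℚ 2), κ.IsCyclotomic →
      ∀ n : ℕ, 1 ≤ n → NewPartEulerFree W κ n → NewPartNonvanishing n (C ϖ * mazurTateElement f 2 n) →
        Even (additiveNewPartIndex f W ϖ κ n - layerMordellWeilRank W κ (n - 1)) ∧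
          0 ≤ additiveNewPartIndex f W ϖ κ n - layerMordellWeilRank W κ (n - 1) := by
  intro N _ f W _ _ ϖ hf hcm h2 hpin κ hκ n hn hE hnv
  refine ⟨Int.even_sub.mpr ?_, sub_nonneg.mpr (hL f W ϖ hf hcm h2 hpin κ hκ n hn hE hnv)⟩
  exact (hS f W ϖ hf hcm h2 hpin κ hκ n hn hE hnv).trans (Int.even_coe_nat _).symm

end Summit.BirchSwinnertonDyer.Rank1Residual.F1Sign2

end
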